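import Summits.ResolutionOfSingularities.ResolutionOfSingularities.Theorems.FrobeniusLadderFRationalResolutionConeCertificateFreeChart
import Summits.ResolutionOfSingularities.ResolutionOfSingularities.Theorems.FrobeniusLadderFRationalResolutionConeCertificateGenerators
import Summits.ResolutionOfSingularities.ResolutionOfSingularities.Theorems.FrobeniusLadderFRationalResolutionWeightKernelBasis
import Mathlib.Tactic.LinearCombination
import Mathlib.Tactic.Linarith
import Mathlib.Tactic.Ring
import Mathlib.Tactic.FinCases
import HarnessLib

/-!
# Crux `FrobeniusLadder.FRationalResolution` (stmt-ResolutionOfSingularities-15317), line `redirect`,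
# stub `stub_diagonalizableQuotientResolution` — THE FIRST CLASS THROUGH THE PIPELINE END TO END: `1/3(1,2)` (`A₂`)

The class certificate of the weight kernel `P = {m ∈ ℕ² : 3 ∣ m₀ + 2 m₁}` (the cyclic quotient singularity `1/3(1,2) = A₂`, wild in
characteristic `3` as `𝔸²/μ₃`): Hilbert basis `G = {(3,0), (1,1), (0,3)}` (box check, `…WeightKernelBasis`), every generator a vertex,
trivial exponent identities, and at each of the three vertices a FREE chart cone `Q = ℕ²` with an explicit `2 × 2` integer matrix
`ι : ℕ² → ℤ²` (membership families from the generator checks of `…ConeCertificateGenerators`; regularity of `κ[ℕ²]` by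
`…MonoidAlgebraFreeRegular.isRegularRing_monoidAlgebra_top`). Fed to
`…ConeCertificateFreeChart.hasResolution_of_isolated_fixedPoints_of_mixedConeCertificate` (p843969):

* ★★★★ `hasResolution_of_isolated_fixedPoints_oneThird` — an integral variety, locally of finite type over any field, whose singular
  points are finitely many isolated fixed points of quotient charts with two regular homogeneous parameters and weight kernel
  `{3 ∣ m₀ + 2 m₁}`, has a resolution of singularities (point blow-ups; every vertex chart is already regular).

Honest label: a TOY instance (surface `A₂`) exercising every glue piece of the naive two-step pipeline; no stub, crux or summit closed.
No definitions, no named facts, no sorry. [folklore; cite: CoxLittleSchenck2011, §1.1, §10.1] [cite: Kato1994, Thm. (3.2)]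
-/

noncomputable section

-- single-problem summit: the doubled namespace component is forced
set_option linter.dupNamespace false

open CategoryTheory AlgebraicGeometry TopologicalSpace IsLocalRing
open Literature.AlgebraicGeometry.Resolution

namespace Summit.ResolutionOfSingularities.ResolutionOfSingularities.Theorems.FRationalResolution.ClassOneThirdOneTwo

/-- The exponent of `p ∈ ℕⁿ` in `ℤⁿ`. -/
local notation3 (prettyPrint := false) "toZ[" n "]" =>
  (Finsupp.mapRange.addMonoidHom (Nat.castAddMonoidHom ℤ) : (Fin n →₀ ℕ) →+ (Fin n →₀ ℤ))

/-! ## §1 `2 × 2` integer matrices as additive maps `ℕ² → ℤ²` -/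

/-- The additive map `ℕ² = ⊤ → ℤ²` of an integer matrix `(a b; c d)` (existence, so that no definition is introduced). [folklore] -/
theorem exists_coneHom (a b c d : ℤ) :
    ∃ ι : ↥(⊤ : AddSubmonoid (Fin 2 →₀ ℕ)) →+ (Fin 2 →₀ ℤ), ∀ u,
      ι u = Finsupp.single 0 (a * ((u : Fin 2 →₀ ℕ) 0 : ℤ) + b * ((u : Fin 2 →₀ ℕ) 1 : ℤ)) +
        Finsupp.single 1 (c * ((u : Fin 2 →₀ ℕ) 0 : ℤ) + d * ((u : Fin 2 →₀ ℕ) 1 : ℤ)) := by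
  refine ⟨AddMonoidHom.mk' (fun u : ↥(⊤ : AddSubmonoid (Fin 2 →₀ ℕ)) =>
      (Finsupp.single 0 (a * ((u : Fin 2 →₀ ℕ) 0 : ℤ) + b * ((u : Fin 2 →₀ ℕ) 1 : ℤ)) +
        Finsupp.single 1 (c * ((u : Fin 2 →₀ ℕ) 0 : ℤ) + d * ((u : Fin 2 →₀ ℕ) 1 : ℤ)) : Fin 2 →₀ ℤ)) ?_, fun u => rfl⟩
  intro u w
  ext i
  simp only [AddSubmonoid.coe_add, Finsupp.coe_add, Pi.add_apply, Nat.cast_add, Finsupp.single_apply]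
  split_ifs <;> ring

/-- Coordinates of the image. [folklore] -/
theorem coneHom_apply {a b c d : ℤ} (ι : ↥(⊤ : AddSubmonoid (Fin 2 →₀ ℕ)) →+ (Fin 2 →₀ ℤ))
    (hι : ∀ u, ι u = Finsupp.single 0 (a * ((u : Fin 2 →₀ ℕ) 0 : ℤ) + b * ((u : Fin 2 →₀ ℕ) 1 : ℤ)) +
      Finsupp.single 1 (c * ((u : Fin 2 →₀ ℕ) 0 : ℤ) + d * ((u : Fin 2 →₀ ℕ) 1 : ℤ))) (u : ↥(⊤ : AddSubmonoid (Fin 2 →₀ ℕ))) :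
    ι u 0 = a * ((u : Fin 2 →₀ ℕ) 0 : ℤ) + b * ((u : Fin 2 →₀ ℕ) 1 : ℤ) ∧
      ι u 1 = c * ((u : Fin 2 →₀ ℕ) 0 : ℤ) + d * ((u : Fin 2 →₀ ℕ) 1 : ℤ) := by
  rw [hι]
  simp only [Finsupp.coe_add, Pi.add_apply, Finsupp.single_apply]
  simp

/-- The image equals a given exponent iff its two coordinates do. [folklore] -/
theorem coneHom_eq {a b c d : ℤ} (ι : ↥(⊤ : AddSubmonoid (Fin 2 →₀ ℕ)) →+ (Fin 2 →₀ ℤ))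
    (hι : ∀ u, ι u = Finsupp.single 0 (a * ((u : Fin 2 →₀ ℕ) 0 : ℤ) + b * ((u : Fin 2 →₀ ℕ) 1 : ℤ)) +
      Finsupp.single 1 (c * ((u : Fin 2 →₀ ℕ) 0 : ℤ) + d * ((u : Fin 2 →₀ ℕ) 1 : ℤ))) (u : ↥(⊤ : AddSubmonoid (Fin 2 →₀ ℕ)))
    (z : Fin 2 →₀ ℤ) (h0 : a * ((u : Fin 2 →₀ ℕ) 0 : ℤ) + b * ((u : Fin 2 →₀ ℕ) 1 : ℤ) = z 0)
    (h1 : c * ((u : Fin 2 →₀ ℕ) 0 : ℤ) + d * ((u : Fin 2 →₀ ℕ) 1 : ℤ) = z 1) : ι u = z := by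
  obtain ⟨e0, e1⟩ := coneHom_apply ι hι u
  ext i
  fin_cases i
  · exact e0.trans h0
  · exact e1.trans h1

/-- Injectivity for a non-zero determinant. [folklore] -/
theorem coneHom_injective {a b c d : ℤ} (hdet : a * d - b * c ≠ 0) (ι : ↥(⊤ : AddSubmonoid (Fin 2 →₀ ℕ)) →+ (Fin 2 →₀ ℤ))
    (hι : ∀ u, ι u = Finsupp.single 0 (a * ((u : Fin 2 →₀ ℕ) 0 : ℤ) + b * ((u : Fin 2 →₀ ℕ) 1 : ℤ)) +
      Finsupp.single 1 (c * ((u : Fin 2 →₀ ℕ) 0 : ℤ) + d * ((u : Fin 2 →₀ ℕ) 1 : ℤ))) : Function.Injective ι := by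
  intro u w h
  obtain ⟨u0, u1⟩ := coneHom_apply ι hι u
  obtain ⟨w0, w1⟩ := coneHom_apply ι hι w
  rw [h] at u0 u1
  have e0 : a * ((u : Fin 2 →₀ ℕ) 0 : ℤ) + b * ((u : Fin 2 →₀ ℕ) 1 : ℤ) = a * ((w : Fin 2 →₀ ℕ) 0 : ℤ) + b * ((w : Fin 2 →₀ ℕ) 1 : ℤ) :=
    u0.symm.trans w0
  have e1 : c * ((u : Fin 2 →₀ ℕ) 0 : ℤ) + d * ((u : Fin 2 →₀ ℕ) 1 : ℤ) = c * ((w : Fin 2 →₀ ℕ) 0 : ℤ) + d * ((w : Fin 2 →₀ ℕ) 1 : ℤ) :=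
    u1.symm.trans w1
  have k0 : (a * d - b * c) * (((u : Fin 2 →₀ ℕ) 0 : ℤ) - ((w : Fin 2 →₀ ℕ) 0 : ℤ)) = 0 := by linear_combination d * e0 - b * e1
  have k1 : (a * d - b * c) * (((u : Fin 2 →₀ ℕ) 1 : ℤ) - ((w : Fin 2 →₀ ℕ) 1 : ℤ)) = 0 := by linear_combination a * e1 - c * e0
  have hu0 : ((u : Fin 2 →₀ ℕ) 0 : ℤ) = ((w : Fin 2 →₀ ℕ) 0 : ℤ) := by
    rcases mul_eq_zero.1 k0 with h' | h'
    · exact absurd h' hdet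
    · linarith
  have hu1 : ((u : Fin 2 →₀ ℕ) 1 : ℤ) = ((w : Fin 2 →₀ ℕ) 1 : ℤ) := by
    rcases mul_eq_zero.1 k1 with h' | h'
    · exact absurd h' hdet
    · linarith
  apply Subtype.ext
  ext i
  fin_cases i
  · exact_mod_cast hu0
  · exact_mod_cast hu1

/-- `ℕ²` is generated by `e₀, e₁`. [folklore] -/
theorem closure_range_single_one_eq_top (n : ℕ) :
    AddSubmonoid.closure (Set.range fun i : Fin n => (Finsupp.single i 1 : Fin n →₀ ℕ)) = ⊤ := by
  refine eq_top_iff.2 fun x hx => ?_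
  clear hx
  induction x using Finsupp.induction with
  | zero => exact zero_mem _
  | single_add i c x _ _ ih =>
    refine add_mem ?_ ih
    have hi : (Finsupp.single i 1 : Fin n →₀ ℕ) ∈ Set.range (fun i : Fin n => (Finsupp.single i 1 : Fin n →₀ ℕ)) := ⟨i, rfl⟩
    have : (Finsupp.single i c : Fin n →₀ ℕ) = c • Finsupp.single i 1 := by
      rw [Finsupp.smul_single, smul_eq_mul, mul_one]
    rw [this]
    exact AddSubmonoid.nsmul_mem _ (AddSubmonoid.subset_closure hi) c

/-! ## §2 The class `1/3(1,2)` -/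

/-- ★★★★ **RESOLUTION OF VARIETIES WHOSE SINGULAR POINTS ARE ISOLATED FIXED POINTS OF TYPE `1/3(1,2)`.** `X` integral, locally of finite
type over a field, finitely many singular points, at each an étale quotient chart with a `D(A)`-fixed prime `𝔔`, two homogeneous regular
parameters `x₀, x₁` of weights `a₀, a₁` and weight kernel `P = {m : Σ mᵢ • aᵢ = 0} = {m : 3 ∣ m₀ + 2 m₁}` (e.g. `A = ℤ/3`, `a = (1, 2)`; any
characteristic). Then `X` has a resolution of singularities. [folklore; cite: CoxLittleSchenck2011, §10.1] [cite: Kato1994, Thm. (3.2)] -/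
theorem hasResolution_of_isolated_fixedPoints_oneThird (k : Type) [Field k] (X : Scheme.{0}) [IsIntegral X]
    (f : X ⟶ Spec (.of k)) [LocallyOfFiniteType f] (hfin : (Scheme.regularLocus X)ᶜ.Finite)
    (hchart : ∀ t : X, t ∉ Scheme.regularLocus X →
      ∃ (k' : Type) (_ : Field k') (A : Type) (_ : DecidableEq A) (_ : AddCommGroup A) (_ : AddMonoid.IsTorsion A)
        (S : Type) (_ : CommRing S) (_ : Algebra k' S) (𝒮 : A → Submodule k' S) (_ : GradedAlgebra 𝒮)
        (_ : Algebra.FiniteType k' S) (φ : Spec (.of (𝒮 0)) ⟶ X) (_ : Etale φ)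
        (𝔔 : Ideal S) (_ : 𝔔.IsPrime) (_ : ∀ a : A, a ≠ 0 → ∀ s ∈ 𝒮 a, s ∈ 𝔔)
        (x : Fin 2 → S) (a : Fin 2 → A) (P : AddSubmonoid (Fin 2 →₀ ℕ))
        (_ : ∀ i, x i ∈ 𝔔 ∧ x i ∈ 𝒮 (a i))
        (_ : Ideal.span (algebraMap S (Localization.AtPrime 𝔔) '' Set.range x) = maximalIdeal (Localization.AtPrime 𝔔))
        (_ : ((2 : ℕ) : WithBot ℕ∞) = ringKrullDim (Localization.AtPrime 𝔔))
        (_ : ∀ m, m ∈ P ↔ Finsupp.weight a m = 0)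
        (_ : ∀ m : Fin 2 →₀ ℕ, m ∈ P ↔ 3 ∣ m 0 + 2 * m 1),
        φ ⟨𝔔.comap (algebraMap (𝒮 0) S), inferInstance⟩ = t) :
    Scheme.HasResolution X := by
  refine MonoidAlgebraLaurent.hasResolution_of_isolated_fixedPoints_of_mixedConeCertificate k X f hfin fun t ht => ?_
  have hc := hchart t ht
  obtain ⟨k', ik, A, iA₁, iA₂, hA, S, iS₁, iS₂, 𝒮, i𝒮, iS₃, φ, iφ, 𝔔, i𝔔, hfix, x, a, P, hxa, hspan, hn, hP, hcls, hφt⟩ := hc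
  -- ### the Hilbert basis `G = {(3,0), (1,1), (0,3)}`
  have hg0P : (Finsupp.single 0 3 : Fin 2 →₀ ℕ) ∈ P := (hcls _).2 (by simp)
  have hg1P : (Finsupp.single 0 1 + Finsupp.single 1 1 : Fin 2 →₀ ℕ) ∈ P := (hcls _).2 (by simp)
  have hg2P : (Finsupp.single 1 3 : Fin 2 →₀ ℕ) ∈ P := (hcls _).2 (by simp)
  let G : Set (Fin 2 →₀ ℕ) := {Finsupp.single 0 3, Finsupp.single 0 1 + Finsupp.single 1 1, Finsupp.single 1 3}
  have hGfin : G.Finite := ((Set.finite_singleton _).insert _).insert _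
  have hGP' : G ⊆ P := by
    rintro g (rfl | rfl | rfl)
    exacts [hg0P, hg1P, hg2P]
  have hG0 : (0 : Fin 2 →₀ ℕ) ∉ G := by
    rintro (h | h | h)
    · have := DFunLike.congr_fun h 0; simp at this
    · have := DFunLike.congr_fun h 0; simp at this
    · have := DFunLike.congr_fun h 1; simp at this
  have hGP : AddSubmonoid.closure G = P := by
    refine WeightKernelBasis.closure_eq_of_box P G hGP' ?_ 3 (by norm_num) ?_ ?_
    · intro m hm g hg hgm
      have hm' := (hcls m).1 hm
      have hg' := (hcls g).1 hg
      have h0 := Finsupp.le_def.1 hgm 0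
      have h1 := Finsupp.le_def.1 hgm 1
      refine (hcls _).2 ?_
      simp only [Finsupp.tsub_apply]
      omega
    · intro i
      fin_cases i
      · exact Or.inl rfl
      · exact Or.inr (Or.inr rfl)
    · intro m hm hm0 hlt
      have hm' := (hcls m).1 hm
      have h0 := hlt 0
      have h1 := hlt 1
      have hne : m 0 ≠ 0 ∨ m 1 ≠ 0 := by
        by_contra h
        push Not at h
        exact hm0 (by ext i; fin_cases i <;> simp [h.1, h.2])
      refine ⟨Finsupp.single 0 1 + Finsupp.single 1 1, Or.inr (Or.inl rfl), ?_, ?_⟩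
      · intro h
        have := DFunLike.congr_fun h 0
        simp at this
      · refine Finsupp.le_def.2 fun i => ?_
        fin_cases i
        · simp; omega
        · simp; omega
  -- ### the enumeration `gen` of `G` (all three are vertices)
  let gen : Fin 3 → ↥P := ![⟨Finsupp.single 0 3, hg0P⟩, ⟨Finsupp.single 0 1 + Finsupp.single 1 1, hg1P⟩, ⟨Finsupp.single 1 3, hg2P⟩]
  have hgen0 : ((gen 0 : ↥P) : Fin 2 →₀ ℕ) = Finsupp.single 0 3 := rfl
  have hgen1 : ((gen 1 : ↥P) : Fin 2 →₀ ℕ) = Finsupp.single 0 1 + Finsupp.single 1 1 := rfl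
  have hgen2 : ((gen 2 : ↥P) : Fin 2 →₀ ℕ) = Finsupp.single 1 3 := rfl
  have hgenG : ∀ i, ((gen i : ↥P) : Fin 2 →₀ ℕ) ∈ G := by
    intro i
    fin_cases i
    · exact Or.inl hgen0
    · exact Or.inr (Or.inl hgen1)
    · exact Or.inr (Or.inr hgen2)
  have hGgen : ∀ g ∈ G, ∃ i, ((gen i : ↥P) : Fin 2 →₀ ℕ) = g := by
    rintro g (rfl | rfl | rfl)
    exacts [⟨0, hgen0⟩, ⟨1, hgen1⟩, ⟨2, hgen2⟩]
  have hv0 : ∀ j, gen j ≠ 0 := by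
    intro j h
    have h' : ((gen j : ↥P) : Fin 2 →₀ ℕ) = 0 := by rw [h]; rfl
    exact hG0 (h' ▸ hgenG j)
  refine ⟨k', ik, A, iA₁, iA₂, hA, S, iS₁, iS₂, 𝒮, i𝒮, iS₃, φ, iφ, 𝔔, i𝔔, hfix, 2, x, a, P, hxa, hspan, hn, hP, G, hGfin, hG0, hGP,
    hφt, 3, gen, hgenG, hGgen, 3, gen, hv0, 1, le_rfl, id, fun _ => 0, fun _ => le_rfl, fun _ => Fin.elim0,
    fun _ l => l.elim0, fun i => by simp, fun j => ?_⟩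
  -- ### the three vertex charts, each a free cone `ℕ²` with an explicit matrix
  -- generic packaging: from a matrix with non-zero determinant and the generator checks
  have pack : ∀ (v : ↥P) (a' b' c' d' : ℤ), a' * d' - b' * c' ≠ 0 →
      (∀ ι : ↥(⊤ : AddSubmonoid (Fin 2 →₀ ℕ)) →+ (Fin 2 →₀ ℤ), (∀ u, ι u =
          Finsupp.single 0 (a' * ((u : Fin 2 →₀ ℕ) 0 : ℤ) + b' * ((u : Fin 2 →₀ ℕ) 1 : ℤ)) +
          Finsupp.single 1 (c' * ((u : Fin 2 →₀ ℕ) 0 : ℤ) + d' * ((u : Fin 2 →₀ ℕ) 1 : ℤ))) →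
        (∀ g ∈ G, ∃ u : ↥(⊤ : AddSubmonoid (Fin 2 →₀ ℕ)), ι u = toZ[2] g) ∧
        (∀ g ∈ G, ∃ u : ↥(⊤ : AddSubmonoid (Fin 2 →₀ ℕ)), ι u = toZ[2] g - toZ[2] (v : Fin 2 →₀ ℕ)) ∧
        (∀ u : ↥(⊤ : AddSubmonoid (Fin 2 →₀ ℕ)), (u : Fin 2 →₀ ℕ) ∈ Set.range (fun i : Fin 2 => (Finsupp.single i 1 : Fin 2 →₀ ℕ)) →
          ∃ (p : ↥P) (r : ℕ) (e : Fin r → ↥P), (∀ i, e i ≠ 0) ∧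
            ι u = toZ[2] (p : Fin 2 →₀ ℕ) + ∑ i, (toZ[2] ((e i : ↥P) : Fin 2 →₀ ℕ) - toZ[2] (v : Fin 2 →₀ ℕ)))) →
      ∃ (n' : ℕ) (Q : AddSubmonoid (Fin n' →₀ ℕ)) (ι : ↥Q →+ (Fin 2 →₀ ℤ)) (_ : Function.Injective ι)
        (_ : ∀ e : ↥P, e ≠ 0 → ∃ u : ↥Q, ι u = toZ[2] (e : Fin 2 →₀ ℕ) - toZ[2] (v : Fin 2 →₀ ℕ))
        (_ : ∀ p : ↥P, ∃ u : ↥Q, ι u = toZ[2] (p : Fin 2 →₀ ℕ))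
        (_ : ∀ u : ↥Q, ∃ (p : ↥P) (r : ℕ) (e : Fin r → ↥P), (∀ i, e i ≠ 0) ∧
          ι u = toZ[2] (p : Fin 2 →₀ ℕ) + ∑ i, (toZ[2] ((e i : ↥P) : Fin 2 →₀ ℕ) - toZ[2] (v : Fin 2 →₀ ℕ))),
        (∀ (κ : Type) [Field κ], IsRegularRing (AddMonoidAlgebra κ ↥Q)) ∨
        ∃ (GQ : Set (Fin n' →₀ ℕ)) (_ : GQ.Finite) (_ : (0 : Fin n' →₀ ℕ) ∉ GQ) (_ : AddSubmonoid.closure GQ = Q),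
          (∀ (κ : Type) [Field κ], ∀ u : ↥Q, (u : Fin n' →₀ ℕ) ∈ GQ →
            IsRegularRing (Localization.Away (AddMonoidAlgebra.single u (1 : κ)))) ∧
          (∀ (K : Type) [Field K], Scheme.IsRegular (affineBlowup (Ideal.span {w : ↥(Algebra.adjoin K
            ((fun d : Fin n' →₀ ℕ => MvPolynomial.monomial d (1 : K)) '' GQ)) |
            ∃ d ∈ GQ, (w : MvPolynomial (Fin n') K) = MvPolynomial.monomial d 1}))) := by
    intro v a' b' c' d' hdet hgen
    obtain ⟨ι, hι⟩ := exists_coneHom a' b' c' d'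
    obtain ⟨hG1, hG2, hG3⟩ := hgen ι hι
    have hPQ := ConeCertificateGenerators.forall_exists_eq_of_generators P ⊤ ι (toZ[2]) G hGP hG1
    refine ⟨2, ⊤, ι, coneHom_injective hdet ι hι,
      ConeCertificateGenerators.forall_exists_eq_sub_of_generators P ⊤ ι (toZ[2]) G hGP _ hG2 hPQ, hPQ,
      ConeCertificateGenerators.forall_exists_decomp_of_generators P ⊤ ι (toZ[2]) _ _ (closure_range_single_one_eq_top 2) hG3,
      Or.inl fun κ _ => MonoidAlgebraLaurent.isRegularRing_monoidAlgebra_top κ 2⟩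
  -- elements of `⊤ ⊆ ℕ²`
  have mem : ∀ w : Fin 2 →₀ ℕ, w ∈ (⊤ : AddSubmonoid (Fin 2 →₀ ℕ)) := fun w => AddSubmonoid.mem_top w
  fin_cases j
  · -- vertex `(3,0)`: chart cone generated by `(3,0), (−2,1)`
    refine pack (gen 0) 3 (-2) 0 1 (by norm_num) fun ι hι => ⟨?_, ?_, ?_⟩
    · rintro g (rfl | rfl | rfl)
      · exact ⟨⟨Finsupp.single 0 1, mem _⟩, coneHom_eq ι hι _ _ (by simp) (by simp)⟩
      · exact ⟨⟨Finsupp.single 0 1 + Finsupp.single 1 1, mem _⟩, coneHom_eq ι hι _ _ (by simp) (by simp)⟩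
      · exact ⟨⟨Finsupp.single 0 2 + Finsupp.single 1 3, mem _⟩, coneHom_eq ι hι _ _ (by simp) (by simp)⟩
    · rintro g (rfl | rfl | rfl)
      · exact ⟨0, by rw [map_zero, hgen0, sub_self]⟩
      · exact ⟨⟨Finsupp.single 1 1, mem _⟩, coneHom_eq ι hι _ _ (by simp [hgen0]) (by simp [hgen0])⟩
      · exact ⟨⟨Finsupp.single 0 1 + Finsupp.single 1 3, mem _⟩, coneHom_eq ι hι _ _ (by simp [hgen0]) (by simp [hgen0])⟩
    · rintro u ⟨i, hi⟩
      fin_cases i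
      · refine ⟨gen 0, 0, Fin.elim0, fun i => i.elim0, ?_⟩
        rw [Finset.univ_eq_empty, Finset.sum_empty, add_zero]
        exact coneHom_eq ι hι _ _ (by simp [← hi, hgen0]) (by simp [← hi, hgen0])
      · refine ⟨0, 1, ![gen 1], fun i => by fin_cases i; exact hv0 1, ?_⟩
        rw [Fin.sum_univ_one]
        exact coneHom_eq ι hι _ _ (by simp [← hi, hgen0, hgen1]) (by simp [← hi, hgen0, hgen1])
  · -- vertex `(1,1)`: chart cone generated by `(2,−1), (−1,2)`
    refine pack (gen 1) 2 (-1) (-1) 2 (by norm_num) fun ι hι => ⟨?_, ?_, ?_⟩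
    · rintro g (rfl | rfl | rfl)
      · exact ⟨⟨Finsupp.single 0 2 + Finsupp.single 1 1, mem _⟩, coneHom_eq ι hι _ _ (by simp) (by simp)⟩
      · exact ⟨⟨Finsupp.single 0 1 + Finsupp.single 1 1, mem _⟩, coneHom_eq ι hι _ _ (by simp) (by simp)⟩
      · exact ⟨⟨Finsupp.single 0 1 + Finsupp.single 1 2, mem _⟩, coneHom_eq ι hι _ _ (by simp) (by simp)⟩
    · rintro g (rfl | rfl | rfl)
      · exact ⟨⟨Finsupp.single 0 1, mem _⟩, coneHom_eq ι hι _ _ (by simp [hgen1]) (by simp [hgen1])⟩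
      · exact ⟨0, by rw [map_zero, hgen1, sub_self]⟩
      · exact ⟨⟨Finsupp.single 1 1, mem _⟩, coneHom_eq ι hι _ _ (by simp [hgen1]) (by simp [hgen1])⟩
    · rintro u ⟨i, hi⟩
      fin_cases i
      · refine ⟨0, 1, ![gen 0], fun i => by fin_cases i; exact hv0 0, ?_⟩
        rw [Fin.sum_univ_one]
        exact coneHom_eq ι hι _ _ (by simp [← hi, hgen0, hgen1]) (by simp [← hi, hgen0, hgen1])
      · refine ⟨0, 1, ![gen 2], fun i => by fin_cases i; exact hv0 2, ?_⟩
        rw [Fin.sum_univ_one]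
        exact coneHom_eq ι hι _ _ (by simp [← hi, hgen1, hgen2]) (by simp [← hi, hgen1, hgen2])
  · -- vertex `(0,3)`: chart cone generated by `(1,−2), (0,3)`
    refine pack (gen 2) 1 0 (-2) 3 (by norm_num) fun ι hι => ⟨?_, ?_, ?_⟩
    · rintro g (rfl | rfl | rfl)
      · exact ⟨⟨Finsupp.single 0 3 + Finsupp.single 1 2, mem _⟩, coneHom_eq ι hι _ _ (by simp) (by simp)⟩
      · exact ⟨⟨Finsupp.single 0 1 + Finsupp.single 1 1, mem _⟩, coneHom_eq ι hι _ _ (by simp) (by simp)⟩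
      · exact ⟨⟨Finsupp.single 1 1, mem _⟩, coneHom_eq ι hι _ _ (by simp) (by simp)⟩
    · rintro g (rfl | rfl | rfl)
      · exact ⟨⟨Finsupp.single 0 3 + Finsupp.single 1 1, mem _⟩, coneHom_eq ι hι _ _ (by simp [hgen2]) (by simp [hgen2])⟩
      · exact ⟨⟨Finsupp.single 0 1, mem _⟩, coneHom_eq ι hι _ _ (by simp [hgen2]) (by simp [hgen2])⟩
      · exact ⟨0, by rw [map_zero, hgen2, sub_self]⟩
    · rintro u ⟨i, hi⟩
      fin_cases i
      · refine ⟨0, 1, ![gen 1], fun i => by fin_cases i; exact hv0 1, ?_⟩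
        rw [Fin.sum_univ_one]
        exact coneHom_eq ι hι _ _ (by simp [← hi, hgen1, hgen2]) (by simp [← hi, hgen1, hgen2])
      · refine ⟨gen 2, 0, Fin.elim0, fun i => i.elim0, ?_⟩
        rw [Finset.univ_eq_empty, Finset.sum_empty, add_zero]
        exact coneHom_eq ι hι _ _ (by simp [← hi, hgen2]) (by simp [← hi, hgen2])

end Summit.ResolutionOfSingularities.ResolutionOfSingularities.Theorems.FRationalResolution.ClassOneThirdOneTwo

end
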